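import Literature.AnabelianGeometry.EtaleTheta.Discharge.Sec2CyclotomeModOfTateTwist
import Literature.AnabelianGeometry.EtaleTheta.SettingModelCyclotomicCharacter
import HarnessLib

/-!
# [EtTh] §2 over §1: `CyclotomeMod` / `CyclotomeTower` from `Δ_Θ ≅ Ẑ(χ)` for THE cyclotomic character
# `χ = SettingModel.chi p` of `G_{ℚ_p}` — the hypothesis `hχ` of `Sec2CyclotomeModOfTateTwist` discharged

Mochizuki, *The Étale Theta Function …* [EtTh], Publ. RIMS **45** (2009), §1 p. 12 «(`Ẑ(1) ≅`) `Δ_Θ`»,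
§2 p. 46 «the natural isomorphism `μ_N ≅ (l·Δ_Θ) ⊗ (ℤ/Nℤ)`», Cor. 2.19 (ii) p. 64 (PRIMS PDF pages).
Cell abc-iut, layer L2, seat abc-iut-L2-t8 (R78 row #5 «t8 adapter layer at the χ-twisted model»;
GAP-LEDGER G-L2t10-1).  PROOF-ONLY (0 definitions).

`Discharge/Sec2CyclotomeModOfTateTwist.lean` builds the identifications from a Tate-twist datum
`(e, χ, hχ, hequiv)` with `χ : G_{ℚ_p} → Aut(Ẑ)` ANY homomorphism acting on `μ_N(ℚ̄_p)` as the Galois action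
does (`hχ`).  For THE cyclotomic character `SettingModel.chi p` of abc-iut-w5-d091's R78 file F3
(`SettingModelCyclotomicCharacter.lean`: `σ μ = μ ^ χ_N(σ)` for every `N`-th root of unity `μ`,
`apply_eq_pow_levelChar_chi`) that hypothesis HOLDS (`galMuN_eq_pow_levelChar_chi`), so the datum a model
(e.g. R78's `modelχ`, F5) has to export reduces to: a continuous bijective `e : Δ_Θ →* Ẑ` with
`e (g d g⁻¹) = χ(aug g) · e d` («`Δ_Θ ≅ Ẑ(1)` as a Galois module»).  Results:
`nonempty_cyclotomeMod_of_chiTwist`, `exists_cyclotomeMod_family_of_chiTwist`,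
`nonempty_cyclotomeTower_of_chiTwist`; v2: the inverse-parametrisation forms `…_of_chiTwist_inv` (`f : Ẑ ⥲ Δ_Θ`,
`g f(t) g⁻¹ = f(χ(aug g) t)`, the `c^t`-coordinates of the R78 models).  HONEST FRAMING: nothing is asserted about an actual curve; the
datum is NOT claimed for any setting here; no side is taken on [IUTchIII] Cor. 3.12; typed ≠ endorsed.
-/

noncomputable section

namespace Literature.AnabelianGeometry.EtaleTheta

open Literature.AnabelianGeometry.SemiGraphs
open CategoryTheory ProfiniteGrp ProfiniteGrp.ProfiniteCompletion

variable (p : ℕ) [Fact p.Prime]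

/-- **`χ = SettingModel.chi p` IS the Galois action on `μ_N`**: `σ ζ = ζ ^ χ_N(σ)` for `ζ ∈ μ_N(ℚ̄_p)`, in the
cell's vocabulary `galMuN` / `MuN p N` (abc-iut-w5-d091's `apply_eq_pow_levelChar_chi` on underlying
elements) — the hypothesis `hχ` of `ThetaSetting.exists_cyclotomeMod_family_of_tateTwist`.
[cite: MochizukiEtTh2009, Def 2.10 p.44] -/
theorem galMuN_eq_pow_levelChar_chi (σ : GQp p) (N : ℕ+) (ζ : MuN p N) :
    galMuN p N σ ζ = ζ ^ (ZHatLevel.levelChar N (SettingModel.chi p σ)).val := by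
  apply Subtype.ext
  apply Units.ext
  rw [galMuN_apply_coe, SubmonoidClass.coe_pow, Units.val_pow_eq_pow_val]
  exact SettingModel.apply_eq_pow_levelChar_chi p σ N
    (by rw [← Units.val_pow_eq_pow_val, (mem_rootsOfUnity _ _).1 ζ.2, Units.val_one])

namespace ThetaSetting

variable {p} (D : ThetaSetting p) {l : ℕ}

/-- **Identifications `μ_N ≅ (l·Δ_Θ) ⊗ ℤ/Nℤ` at all levels, compatibly, from `Δ_Θ ≅ Ẑ(χ)`** for the
cyclotomic character `χ = SettingModel.chi p`: datum = a continuous bijective `e : Δ_Θ →* Ẑ` with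
`e (g d g⁻¹) = χ(aug g) · e d`. [cite: MochizukiEtTh2009, Def 2.13 (ii) p.48] -/
theorem exists_cyclotomeMod_family_of_chiTwist (hl : 0 < l)
    (e : ↥D.DeltaTheta →* completion (GrpCat.of (Multiplicative ℤ))) (he : Continuous e)
    (hbij : Function.Bijective e)
    (hequiv : ∀ (g : D.PiTemp) (d : ↥D.DeltaTheta),
      e (MulAut.conjNormal (D.toTheta g) d) = SettingModel.chi p (D.aug.toMonoidHom g) (e d)) :
    ∃ mods : ∀ N : ℕ+, D.CyclotomeMod l N,
      ∀ (M M' : ℕ+) (h : (M : ℕ) ∣ (M' : ℕ)) (x : ↥(D.lDeltaTheta l)),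
        MuN.red p M M' h ((mods M').red x) = (mods M).red x :=
  D.exists_cyclotomeMod_family_of_tateTwist hl e he hbij (SettingModel.chi p)
    (galMuN_eq_pow_levelChar_chi p) hequiv

/-- **`CyclotomeMod l N` is inhabited at every level** given `Δ_Θ ≅ Ẑ(χ)`, `χ = SettingModel.chi p`.
[cite: MochizukiEtTh2009, Def 2.13 p.46] -/
theorem nonempty_cyclotomeMod_of_chiTwist (hl : 0 < l)
    (e : ↥D.DeltaTheta →* completion (GrpCat.of (Multiplicative ℤ))) (he : Continuous e)
    (hbij : Function.Bijective e)
    (hequiv : ∀ (g : D.PiTemp) (d : ↥D.DeltaTheta),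
      e (MulAut.conjNormal (D.toTheta g) d) = SettingModel.chi p (D.aug.toMonoidHom g) (e d))
    (N : ℕ+) : Nonempty (D.CyclotomeMod l N) :=
  D.nonempty_cyclotomeMod_of_tateTwist hl e he hbij (SettingModel.chi p) (galMuN_eq_pow_levelChar_chi p)
    hequiv N

/-- **A `CyclotomeTower l E` over EVERY cofinal chain `E ∋ 1`** given `Δ_Θ ≅ Ẑ(χ)`, `χ = SettingModel.chi p`
(GAP-LEDGER G-L2t10-1 modulo that datum). [cite: MochizukiEtTh2009, Cor 2.19 (ii) p.64] -/
theorem nonempty_cyclotomeTower_of_chiTwist (hl : 0 < l)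
    (e : ↥D.DeltaTheta →* completion (GrpCat.of (Multiplicative ℤ))) (he : Continuous e)
    (hbij : Function.Bijective e)
    (hequiv : ∀ (g : D.PiTemp) (d : ↥D.DeltaTheta),
      e (MulAut.conjNormal (D.toTheta g) d) = SettingModel.chi p (D.aug.toMonoidHom g) (e d))
    {E : Set ℕ+} (one_mem : (1 : ℕ+) ∈ E) (cofinal : ∀ n : ℕ+, ∃ M ∈ E, n ∣ M)
    (total : ∀ M ∈ E, ∀ M' ∈ E, M ∣ M' ∨ M' ∣ M) : Nonempty (D.CyclotomeTower l E) :=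
  D.nonempty_cyclotomeTower_of_tateTwist hl e he hbij (SettingModel.chi p) (galMuN_eq_pow_levelChar_chi p)
    hequiv one_mem cofinal total

/-- **Inverse parametrisation, `χ = SettingModel.chi p`**: from a continuous bijective `f : Ẑ →* Δ_Θ` (`Δ_Θ`
Hausdorff) with `g · f(t) · g⁻¹ = f (χ(aug g) · t)` — the `c^t`-coordinates of the theta centre in the R78 models
(`SettingModelThetaCentreZHat.twist_cPow_mul_inv_mem_closure₃`) — the compatible family of identifications
`μ_N ≅ (l·Δ_Θ) ⊗ ℤ/Nℤ` at all levels. [cite: MochizukiEtTh2009, Def 2.13 (ii) p.48] -/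
theorem exists_cyclotomeMod_family_of_chiTwist_inv [T2Space ↥D.DeltaTheta] (hl : 0 < l)
    (f : completion (GrpCat.of (Multiplicative ℤ)) →* ↥D.DeltaTheta) (hf : Continuous f)
    (hbij : Function.Bijective f)
    (hequiv : ∀ (g : D.PiTemp) (t : completion (GrpCat.of (Multiplicative ℤ))),
      MulAut.conjNormal (D.toTheta g) (f t) = f (SettingModel.chi p (D.aug.toMonoidHom g) t)) :
    ∃ mods : ∀ N : ℕ+, D.CyclotomeMod l N,
      ∀ (M M' : ℕ+) (h : (M : ℕ) ∣ (M' : ℕ)) (x : ↥(D.lDeltaTheta l)),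
        MuN.red p M M' h ((mods M').red x) = (mods M).red x :=
  D.exists_cyclotomeMod_family_of_tateTwist_inv hl f hf hbij (SettingModel.chi p)
    (galMuN_eq_pow_levelChar_chi p) hequiv

/-- **A `CyclotomeTower l E` over every cofinal chain `E ∋ 1`** from the inverse parametrisation
`f : Ẑ ⥲ Δ_Θ ≅ Ẑ(χ)`, `χ = SettingModel.chi p`. [cite: MochizukiEtTh2009, Cor 2.19 (ii) p.64] -/
theorem nonempty_cyclotomeTower_of_chiTwist_inv [T2Space ↥D.DeltaTheta] (hl : 0 < l)
    (f : completion (GrpCat.of (Multiplicative ℤ)) →* ↥D.DeltaTheta) (hf : Continuous f)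
    (hbij : Function.Bijective f)
    (hequiv : ∀ (g : D.PiTemp) (t : completion (GrpCat.of (Multiplicative ℤ))),
      MulAut.conjNormal (D.toTheta g) (f t) = f (SettingModel.chi p (D.aug.toMonoidHom g) t))
    {E : Set ℕ+} (one_mem : (1 : ℕ+) ∈ E) (cofinal : ∀ n : ℕ+, ∃ M ∈ E, n ∣ M)
    (total : ∀ M ∈ E, ∀ M' ∈ E, M ∣ M' ∨ M' ∣ M) : Nonempty (D.CyclotomeTower l E) :=
  D.nonempty_cyclotomeTower_of_tateTwist_inv hl f hf hbij (SettingModel.chi p) (galMuN_eq_pow_levelChar_chi p)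
    hequiv one_mem cofinal total

end ThetaSetting

end Literature.AnabelianGeometry.EtaleTheta

end
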